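import Literature.Probability.RandomPlanarGeometry.ConformalRectangle
import Literature.Probability.RandomPlanarGeometry.CurveSpace
import HarnessLib

/-!
# The conformal welding homeomorphism of a simple chord of a four-marked Jordan domain

Fix a conformal rectangle `Q = (Ω; a, c_L, b, c_R)` (`a = Q.pt 0`, `c_L = Q.pt 1`, `b = Q.pt 2`,
`c_R = Q.pt 3`) and a simple chord `γ` of the Dobrushin domain `Q.chord 0 2 = (Ω; a, b)` (a simple
curve from `a` to `b` in `Ω̄` meeting `∂Ω` only at `a, b`: a cross-cut). By Newman's cross-cut
theorem (`Literature.Topology.PlaneTopology.Newman1939_crosscut`, proved in the tree) `Ω ∖ γ` has two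
components, the **banks** `L` (`c_L ∈ L̄`) and `R` (`c_R ∈ R̄`), Jordan domains bounded by `γ` and
an arc of `∂Ω`; by Riemann mapping + Carathéodory + three-point normalisation (Pommerenke 1992,
Thm. 2.6, Cor. 2.7) there are unique conformal maps `φ : ℍₒ → L` (`0 ↦ a`, `∞ ↦ b`, `s ↦ c_L`) and
`ψ : ℍₒ → R` (`0 ↦ a`, `∞ ↦ b`, `-s ↦ c_R`), `s = ±1` the orientation sign of `∂Ω` (conformal
maps preserve orientation, so one sign only). Then `γ = φ̄(-s·(0,∞)) = ψ̄(s·(0,∞))` and the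
**conformal welding** of `γ` is the increasing homeomorphism `h` of `(0, ∞)` with

`ψ̄ (s·x) = φ̄ (-s·h(x))` (`x > 0`), i.e. `h = (-s·φ̄⁻¹) ∘ ψ̄ ∘ (s·)`:

Pommerenke's "sense-preserving homeomorphism (conformal welding) `f*⁻¹ ∘ f`" of the two
complementary domains (1992, §2.3 proof of Cor. 2.8; §6.5 eq. (10)), Sheffield's welding
homeomorphism `R : [0₋, 0] → [0, 0₊]` of the two sides of an SLE curve (2016, §1.4,
Thms. 1.3–1.4), in the normalised half-plane charts of the banks used by the route
`CriticalPhenomena/SAWWeldingIdentification` (items `WeldingSetup`, `WeldingRigidity`,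
`WeldingContinuity`, `WeldingLawOfLimit`).

## Contents

* `MarkedDomain.IsSimpleChord D γ` — `γ : CurveClass ℂ` is a simple chord of the Dobrushin domain
  `(D; D.pt 0, D.pt 1)`; VERBATIM the clause inlined by the SAW routes (`SAWWeldingIdentification`,
  `SAWRestrictionRigidity`, `SAWFrontierHomotopy`, `SAWLoopFugacityFlow`): for a conformal rectangle
  `(Q.chord 0 2 _).IsSimpleChord γ` unfolds by `Iff.rfl` (`ConformalRectangle.isSimpleChord_iff`).
* `WeldingConfig Q γ` — a **welding configuration** `(s, L, R, φ, ψ)`: sign, banks (the route's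
  eight-clause "components of `Ω ∖ γ`, `c_L ∈ L̄`, `c_R ∈ R̄`") and normalised uniformisers
  `φ : ConformalEquiv ℍₒ L`, `ψ : ConformalEquiv ℍₒ R` (the route's six boundary-value clauses), a
  hypothesis structure: route hypotheses repackage as `⟨s, L, R, φ, ψ, hs, hbanks, hnorm⟩`.
* `WeldingConfig.IsWeld c x y` — the welding relation `ψ̄ (s x) = φ̄ (-(s y))` on
  `ConformalEquiv.boundaryExtension`s, syntactically the route's equation; `WeldingConfig.weld c` —
  the welding function of ONE configuration: for `x > 0` the (chosen; classically unique) positive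
  solution `y`, junk `0` for `x ≤ 0` or if none exists.
* `conformalWelding Q γ : ℝ → ℝ` — THE conformal welding: `c.weld` for a chosen configuration `c`
  when `γ` is a simple chord of `Q.chord 0 2` admitting one, the zero function otherwise (so `0`
  off the set of simple chords, as the route's measurability argument wants).
* Proved API: junk/sign lemmas, `weld_nonneg`, `weld_pos`, `isWeld_weld`, `weld_eq_of_isWeld`,
  `weld_eq_weld_of_iff`, `conformalWelding_nonneg`, `exists_conformalWelding_eq_weld`, and the
  REDUCTIONS `conformalWelding_eq_weld` / `conformalWelding_spec` / `conformalWelding_eq_of_isWeld`: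
  given configuration independence of the relation and existence of positive solutions,
  `conformalWelding Q γ x > 0` solves the welding equation of EVERY configuration — clause (ii) of
  the route item `WeldingSetup`, verbatim.

## Deliberately NOT here (no named fact is introduced)

Left to the route items `WeldingSetup` / `WeldingContinuity`, all resting on results in the tree:
(1) existence of a configuration for every simple chord and the right sign
(`Newman1939_crosscut_holds`, `exists_conformalEquiv_upperHalfPlaneSet_holds`,
`JordanDomain.continuousOn_boundaryExtension_holds`, `existsUnique_real_or_infty_holds`, cf.
`MarkedDomain.exists_isUniformizing_holds`); (2) configuration independence of `IsWeld` (sign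
forced by orientation, banks = the two components, two normalised uniformisers of one bank agree on
`ℍₒ` — Pommerenke Cor. 2.7, cf. `IsChordalUniformizing.exists_eq_trans_smul_holds` — hence have
equal `boundaryExtension = extendFrom ℍₒ`); (3) existence, uniqueness, strict monotonicity,
continuity in `x` of the solution (Pommerenke Thm. 2.6); (4) Borel measurability in `γ`, continuity
along chords converging to a simple chord (Pommerenke Thm. 1.8, §2.2–2.3, Cor. 2.4). The definition
is by choice, like `drivingFunction` (`LoewnerDescription.lean`); (2)–(3) make it canonical.

## References

* [Sheffield2016] S. Sheffield, *Conformal weldings of random surfaces: SLE and the quantum gravity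
  zipper*, Ann. Probab. 44 (2016), §1.4 (Thms. 1.3–1.4: the welding homeomorphism `R` of the two
  sides of SLE_κ, `κ < 4`, and that it determines the curve) and §1.5 (the general conformal
  welding problem `ψ₁ ∘ ψ₂⁻¹ = φ`); arXiv:1012.4797, pp. 7–8.
* [PommerenkeBBCM1992] Ch. Pommerenke, *Boundary Behaviour of Conformal Maps* (1992), §2.3
  (Thm. 2.6 Carathéodory; Cor. 2.7 three-point uniqueness; proof of Cor. 2.8, `φ = f*⁻¹ ∘ f`),
  §6.5 eq. (10) ("conformal welding").
* [AhlforsCA1979] L. V. Ahlfors, *Complex Analysis*, 3rd ed. (1979), Ch. 6 §1.1.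
-/

noncomputable section

open Set Filter
open scoped _root_.Topology
open UpperHalfPlane (upperHalfPlaneSet)

namespace Literature.Probability.RandomPlanarGeometry

/-! ### Simple chords of a Dobrushin domain -/

namespace MarkedDomain

/-- The curve class `γ` is a **simple chord** of the Dobrushin domain `(D; a, b)`
(`a = D.pt 0`, `b = D.pt 1`): `γ` is simple, runs from `a` to `b`, stays in `closure D` and meets
`∂D` only at `a` and `b` — a cross-cut of `D` from `a` to `b` in the sense of Newman (1939, Ch. V
§11), given as a curve modulo reparametrisation. Verbatim the clause "simple chord of `(Ω; a, b)`"
inlined by the SAW routes of `CriticalPhenomena/SAWScalingLimit`. [folklore] -/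
def IsSimpleChord (D : MarkedDomain 2) (γ : CurveClass ℂ) : Prop :=
  γ ∈ CurveClass.simple ∧ γ.source = D.pt 0 ∧ γ.target = D.pt 1 ∧ γ.range ⊆ closure D.carrier ∧
    γ.range ∩ frontier D.carrier ⊆ {D.pt 0, D.pt 1}

namespace IsSimpleChord

variable {D : MarkedDomain 2} {γ : CurveClass ℂ}

/-- A simple chord is a simple curve class. [folklore] -/
theorem simple (h : D.IsSimpleChord γ) : γ ∈ CurveClass.simple := h.1

/-- A simple chord of `(D; a, b)` starts at `a`. [folklore] -/
theorem source_eq (h : D.IsSimpleChord γ) : γ.source = D.pt 0 := h.2.1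

/-- A simple chord of `(D; a, b)` ends at `b`. [folklore] -/
theorem target_eq (h : D.IsSimpleChord γ) : γ.target = D.pt 1 := h.2.2.1

/-- A simple chord stays in the closed domain. [folklore] -/
theorem range_subset_closure (h : D.IsSimpleChord γ) : γ.range ⊆ closure D.carrier := h.2.2.2.1

/-- A simple chord meets the boundary only at its two marked endpoints. [folklore] -/
theorem range_inter_frontier_subset (h : D.IsSimpleChord γ) :
    γ.range ∩ frontier D.carrier ⊆ {D.pt 0, D.pt 1} := h.2.2.2.2

/-- Off its endpoints a simple chord runs inside the open domain: `γ ∖ {a, b} ⊆ D`. [folklore] -/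
theorem range_diff_subset (h : D.IsSimpleChord γ) : γ.range \ {D.pt 0, D.pt 1} ⊆ D.carrier := by
  intro z hz
  have hzcl : z ∈ closure D.carrier := h.range_subset_closure hz.1
  rw [closure_eq_self_union_frontier] at hzcl
  rcases hzcl with hzD | hzfr
  · exact hzD
  · exact absurd (h.range_inter_frontier_subset ⟨hz.1, hzfr⟩) hz.2

/-- The endpoints of a simple chord are distinct boundary points, so the chord is not reduced to
a point: its trace contains the two distinct points `a ≠ b`. [folklore] -/
theorem source_ne_target (h : D.IsSimpleChord γ) : γ.source ≠ γ.target := by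
  rw [h.source_eq, h.target_eq]
  intro hab
  have h01 : (0 : Fin 2) = 1 := D.pt_injective hab
  exact absurd h01 (by decide)

end IsSimpleChord

end MarkedDomain

namespace ConformalRectangle

/-- For a conformal rectangle `Q = (Ω; a, c_L, b, c_R)`, being a simple chord of the Dobrushin
domain `Q.chord 0 2 = (Ω; a, b)` unfolds (definitionally) to the clause inlined by the route
`CriticalPhenomena/SAWWeldingIdentification`. [folklore] -/
theorem isSimpleChord_iff (Q : ConformalRectangle) (γ : CurveClass ℂ) (h02 : (0 : Fin 4) < 2) :
    (Q.chord 0 2 h02).IsSimpleChord γ ↔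
      γ ∈ CurveClass.simple ∧ γ.source = Q.pt 0 ∧ γ.target = Q.pt 2 ∧
        γ.range ⊆ closure Q.carrier ∧ γ.range ∩ frontier Q.carrier ⊆ {Q.pt 0, Q.pt 2} :=
  Iff.rfl

end ConformalRectangle

/-! ### Boundary extensions depend only on the values on the source -/

namespace ConformalEquiv

/-- Conformal equivalences with the same source that agree on it have the same boundary extension
— at EVERY point, junk values included — because `boundaryExtension φ = extendFrom U φ` only sees
the filters `map φ (𝓝[U] x)`. (The targets may differ syntactically, e.g. two presentations of the
same bank.) This is the step turning "normalised uniformisers of a bank agree on `ℍₒ`"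
(Pommerenke 1992, Cor. 2.7) into configuration independence of the welding relation. [folklore] -/
theorem boundaryExtension_congr {U V V' : Set ℂ} (φ : ConformalEquiv U V) (φ' : ConformalEquiv U V')
    (h : EqOn φ φ' U) : φ.boundaryExtension = φ'.boundaryExtension := by
  funext x
  unfold boundaryExtension extendFrom limUnder
  rw [Filter.map_congr h.eventuallyEq_nhdsWithin]

end ConformalEquiv

/-! ### Welding configurations: banks and normalised uniformisers -/

/-- A **welding configuration** of the curve class `γ` in the conformal rectangle
`Q = (Ω; a, c_L, b, c_R)`: a sign `sign = ±1`, two **banks** `left, right` — disjoint open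
connected sets with `left ∪ right = Ω ∖ γ`, `c_L ∈ closure left`, `c_R ∈ closure right` (for a
simple chord: the two components of `Ω ∖ γ`, Newman 1939 Thm. 11·7–11·8) — and **normalised
uniformisers** `leftMap : ℍₒ → left` with boundary values `0 ↦ a`, `∞ ↦ b`, `sign ↦ c_L` and
`rightMap : ℍₒ → right` with `0 ↦ a`, `∞ ↦ b`, `-sign ↦ c_R` (Riemann mapping + Carathéodory +
three-point normalisation, Pommerenke 1992 Cor. 2.7; the sign is the orientation of `∂Ω`, forced
because conformal maps preserve orientation). The two property fields are verbatim the "banks" and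
"normalised" hypotheses of the route `CriticalPhenomena/SAWWeldingIdentification`.
[cite: PommerenkeBBCM1992, §2.3 Thm. 2.6 and Cor. 2.7] -/
structure WeldingConfig (Q : ConformalRectangle) (γ : CurveClass ℂ) where
  /-- The orientation sign `s = ±1`. -/
  sign : ℝ
  /-- The left bank `L` (the component of `Ω ∖ γ` with `c_L = Q.pt 1` in its closure). -/
  left : Set ℂ
  /-- The right bank `R` (the component of `Ω ∖ γ` with `c_R = Q.pt 3` in its closure). -/
  right : Set ℂ
  /-- The normalised uniformiser `φ : ℍₒ → L`. -/
  leftMap : ConformalEquiv upperHalfPlaneSet left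
  /-- The normalised uniformiser `ψ : ℍₒ → R`. -/
  rightMap : ConformalEquiv upperHalfPlaneSet right
  /-- The sign is `±1`. -/
  sign_eq : sign = 1 ∨ sign = -1
  /-- `L, R` are the banks of `γ` in `Ω`: disjoint, open, connected, covering `Ω ∖ γ`, with
  `c_L ∈ L̄` and `c_R ∈ R̄`. -/
  banks : left ∪ right = Q.carrier \ γ.range ∧ Disjoint left right ∧ IsOpen left ∧ IsOpen right ∧
    IsConnected left ∧ IsConnected right ∧ Q.pt 1 ∈ closure left ∧ Q.pt 3 ∈ closure right
  /-- Three-point normalisations: `φ : (0, ∞, s) ↦ (a, b, c_L)`, `ψ : (0, ∞, -s) ↦ (a, b, c_R)`. -/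
  normalised : leftMap.HasBoundaryValue 0 (Q.pt 0) ∧ leftMap.HasBoundaryValueAtInfty (Q.pt 2) ∧
    leftMap.HasBoundaryValue ((sign : ℝ) : ℂ) (Q.pt 1) ∧ rightMap.HasBoundaryValue 0 (Q.pt 0) ∧
    rightMap.HasBoundaryValueAtInfty (Q.pt 2) ∧ rightMap.HasBoundaryValue (-((sign : ℝ) : ℂ)) (Q.pt 3)

namespace WeldingConfig

variable {Q : ConformalRectangle} {γ : CurveClass ℂ}

/-- The sign of a welding configuration is `1` or `-1`, hence nonzero. [folklore] -/
theorem sign_ne_zero (c : WeldingConfig Q γ) : c.sign ≠ 0 := by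
  rcases c.sign_eq with h | h <;> rw [h] <;> norm_num

/-- The sign of a welding configuration squares to one: `s * s = 1`. [folklore] -/
theorem sign_mul_self (c : WeldingConfig Q γ) : c.sign * c.sign = 1 := by
  rcases c.sign_eq with h | h <;> rw [h] <;> norm_num

/-- The banks of a welding configuration lie in the domain and avoid the chord. [folklore] -/
theorem left_subset (c : WeldingConfig Q γ) : c.left ⊆ Q.carrier \ γ.range := by
  rw [← c.banks.1]
  exact subset_union_left

/-- The banks of a welding configuration lie in the domain and avoid the chord. [folklore] -/
theorem right_subset (c : WeldingConfig Q γ) : c.right ⊆ Q.carrier \ γ.range := by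
  rw [← c.banks.1]
  exact subset_union_right

/-- **The welding relation** of the configuration `c = (s, L, R, φ, ψ)` between a parameter
`x` of the right chart and a parameter `y` of the left chart: the boundary extensions satisfy
`ψ̄ (s·x) = φ̄ (-(s·y))` — for `x, y > 0` both sides are the same point of the chord `γ`, reached
from the right bank at `s x ∈ ∂ℍₒ` and from the left bank at `-s y ∈ ∂ℍₒ`. Syntactically the
equation of the route `CriticalPhenomena/SAWWeldingIdentification` (items `WeldingSetup`,
`WeldingRigidity`, `WeldingContinuity`). Sheffield (2016), §1.4: `f_T(z₋) = f_T(z₊) = z`;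
Pommerenke (1992), §2.3: `φ(ζ) = f*⁻¹(f(ζ))`. [cite: Sheffield2016, §1.4 (Thms. 1.3–1.4)] -/
def IsWeld (c : WeldingConfig Q γ) (x y : ℝ) : Prop :=
  c.rightMap.boundaryExtension ((c.sign * x : ℝ) : ℂ) =
    c.leftMap.boundaryExtension ((-(c.sign * y) : ℝ) : ℂ)

/-- Unfolding the welding relation. [folklore] -/
theorem isWeld_iff (c : WeldingConfig Q γ) (x y : ℝ) :
    c.IsWeld x y ↔ c.rightMap.boundaryExtension ((c.sign * x : ℝ) : ℂ) =
      c.leftMap.boundaryExtension ((-(c.sign * y) : ℝ) : ℂ) :=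
  Iff.rfl

/-- **Configuration independence, reduced to the uniformisers**: two welding configurations with
the same sign whose left uniformisers agree on `ℍₒ` and whose right uniformisers agree on `ℍₒ`
(as happens once the banks are identified, by uniqueness of three-point-normalised conformal maps,
Pommerenke 1992 Cor. 2.7) have the same welding relation. [folklore] -/
theorem isWeld_iff_of_eqOn (c c' : WeldingConfig Q γ) (hs : c.sign = c'.sign)
    (hL : EqOn c.leftMap c'.leftMap upperHalfPlaneSet)
    (hR : EqOn c.rightMap c'.rightMap upperHalfPlaneSet) (x y : ℝ) :
    c.IsWeld x y ↔ c'.IsWeld x y := by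
  unfold IsWeld
  rw [c.leftMap.boundaryExtension_congr c'.leftMap hL,
    c.rightMap.boundaryExtension_congr c'.rightMap hR, hs]

open scoped Classical in
/-- **The welding function of one configuration** `c = (s, L, R, φ, ψ)`: for `x > 0`, a positive
solution `y` of the welding relation `ψ̄ (s x) = φ̄ (-s y)` (chosen; it is unique because the
boundary correspondence of `φ` is injective, Pommerenke 1992 Thm. 2.6), and the documented junk
value `0` when `x ≤ 0` or when no positive solution exists. For the configuration of a simple
chord this is the conformal welding homeomorphism `h : (0, ∞) → (0, ∞)`, `ψ(s x) = φ(-s h(x))`.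
[cite: PommerenkeBBCM1992, §2.3 (proof of Cor. 2.8) and §6.5 eq. (10)] -/
def weld (c : WeldingConfig Q γ) (x : ℝ) : ℝ :=
  if h : 0 < x ∧ ∃ y : ℝ, 0 < y ∧ c.IsWeld x y then h.2.choose else 0

/-- Junk value: the welding function vanishes at non-positive parameters. [folklore] -/
theorem weld_of_nonpos (c : WeldingConfig Q γ) {x : ℝ} (hx : x ≤ 0) : c.weld x = 0 := by
  have hn : ¬ (0 < x ∧ ∃ y : ℝ, 0 < y ∧ c.IsWeld x y) := fun h => absurd h.1 (not_lt.2 hx)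
  unfold weld
  rw [dif_neg hn]

/-- Junk value: the welding function vanishes where the welding relation has no positive
solution. [folklore] -/
theorem weld_of_not_exists (c : WeldingConfig Q γ) {x : ℝ} (hx : ¬ ∃ y : ℝ, 0 < y ∧ c.IsWeld x y) :
    c.weld x = 0 := by
  have hn : ¬ (0 < x ∧ ∃ y : ℝ, 0 < y ∧ c.IsWeld x y) := fun h => absurd h.2 hx
  unfold weld
  rw [dif_neg hn]

/-- The welding function is non-negative (positive solution or junk `0`). [folklore] -/
theorem weld_nonneg (c : WeldingConfig Q γ) (x : ℝ) : 0 ≤ c.weld x := by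
  unfold weld
  split_ifs with h
  · exact h.2.choose_spec.1.le
  · exact le_rfl

/-- If the welding relation at `x > 0` has a positive solution, the welding function is positive
there. [folklore] -/
theorem weld_pos (c : WeldingConfig Q γ) {x : ℝ} (hx : 0 < x) (h : ∃ y : ℝ, 0 < y ∧ c.IsWeld x y) :
    0 < c.weld x := by
  have hc : 0 < x ∧ ∃ y : ℝ, 0 < y ∧ c.IsWeld x y := ⟨hx, h⟩
  unfold weld
  rw [dif_pos hc]
  exact hc.2.choose_spec.1

/-- If the welding relation at `x > 0` has a positive solution, the welding function solves it:
`ψ̄ (s x) = φ̄ (-s · c.weld x)`. [folklore] -/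
theorem isWeld_weld (c : WeldingConfig Q γ) {x : ℝ} (hx : 0 < x)
    (h : ∃ y : ℝ, 0 < y ∧ c.IsWeld x y) : c.IsWeld x (c.weld x) := by
  have hc : 0 < x ∧ ∃ y : ℝ, 0 < y ∧ c.IsWeld x y := ⟨hx, h⟩
  unfold weld
  rw [dif_pos hc]
  exact hc.2.choose_spec.2

/-- The welding function is positive exactly where `x > 0` and the welding relation has a positive
solution. [folklore] -/
theorem weld_pos_iff (c : WeldingConfig Q γ) {x : ℝ} :
    0 < c.weld x ↔ 0 < x ∧ ∃ y : ℝ, 0 < y ∧ c.IsWeld x y := by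
  refine ⟨fun h => ?_, fun h => c.weld_pos h.1 h.2⟩
  by_contra hne
  have : c.weld x = 0 := by
    unfold weld
    rw [dif_neg hne]
  exact h.ne' this

/-- **Uniqueness transfer**: if positive solutions of the welding relation at `x > 0` are unique
(injectivity of the boundary correspondence of `φ` on the half-line, Pommerenke 1992 Thm. 2.6),
then the welding function IS the positive solution. [folklore] -/
theorem weld_eq_of_isWeld (c : WeldingConfig Q γ) {x y : ℝ} (hx : 0 < x) (hy : 0 < y)
    (hw : c.IsWeld x y)
    (huniq : ∀ ⦃y₁ y₂ : ℝ⦄, 0 < y₁ → 0 < y₂ → c.IsWeld x y₁ → c.IsWeld x y₂ → y₁ = y₂) :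
    c.weld x = y :=
  huniq (c.weld_pos hx ⟨y, hy, hw⟩) hy (c.isWeld_weld hx ⟨y, hy, hw⟩) hw

/-- `Exists.choose` does not depend on the (propositionally equal) predicate or on the proof.
[folklore] -/
private theorem choose_eq_choose {α : Sort*} {p q : α → Prop} (hp : ∃ a, p a) (hq : ∃ a, q a)
    (h : p = q) : hp.choose = hq.choose := by
  subst h
  rfl

/-- Two configurations whose welding relations agree at positive parameters have the same welding
function. (With configuration independence of the relation — uniqueness of normalised
uniformisers, Pommerenke 1992 Cor. 2.7 — this makes the welding canonical.) [folklore] -/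
theorem weld_eq_weld_of_iff (c c' : WeldingConfig Q γ)
    (h : ∀ (x y : ℝ), 0 < x → 0 < y → (c.IsWeld x y ↔ c'.IsWeld x y)) : c.weld = c'.weld := by
  funext x
  by_cases hx : 0 < x
  · by_cases hex : ∃ y : ℝ, 0 < y ∧ c.IsWeld x y
    · have hex' : ∃ y : ℝ, 0 < y ∧ c'.IsWeld x y := by
        obtain ⟨y, hy, hw⟩ := hex
        exact ⟨y, hy, (h x y hx hy).1 hw⟩
      have hc : 0 < x ∧ ∃ y : ℝ, 0 < y ∧ c.IsWeld x y := ⟨hx, hex⟩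
      have hc' : 0 < x ∧ ∃ y : ℝ, 0 < y ∧ c'.IsWeld x y := ⟨hx, hex'⟩
      have hpq : (fun y : ℝ => 0 < y ∧ c.IsWeld x y) = fun y : ℝ => 0 < y ∧ c'.IsWeld x y :=
        funext fun y => propext (and_congr_right fun hy => h x y hx hy)
      unfold weld
      rw [dif_pos hc, dif_pos hc']
      exact choose_eq_choose hc.2 hc'.2 hpq
    · have hex' : ¬ ∃ y : ℝ, 0 < y ∧ c'.IsWeld x y := by
        rintro ⟨y, hy, hw⟩
        exact hex ⟨y, hy, (h x y hx hy).2 hw⟩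
      rw [c.weld_of_not_exists hex, c'.weld_of_not_exists hex']
  · rw [c.weld_of_nonpos (not_lt.1 hx), c'.weld_of_nonpos (not_lt.1 hx)]

end WeldingConfig

/-! ### The conformal welding -/

open scoped Classical in
/-- **The conformal welding** `x ↦ h(x)` of the curve class `γ` in the conformal rectangle
`Q = (Ω; a, c_L, b, c_R)`: if `γ` is a simple chord of the Dobrushin domain `Q.chord 0 2 = (Ω; a, b)`
admitting a welding configuration `(s, L, R, φ, ψ)` (banks and three-point-normalised uniformisers
`φ : (ℍₒ; 0, ∞, s) → (L; a, b, c_L)`, `ψ : (ℍₒ; 0, ∞, -s) → (R; a, b, c_R)`), then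
`conformalWelding Q γ` is the welding function of a CHOSEN such configuration: for `x > 0` the
positive `h(x)` with `ψ (s·x) = φ (-s·h(x))` on boundary extensions (the point of `γ` reached from
the right bank at `s x` is reached from the left bank at `-s h(x)`), junk `0` for `x ≤ 0`;
otherwise (not a simple chord, or no configuration) the junk value `0`. This is Sheffield's welding
homeomorphism `R : [0₋, 0] → [0, 0₊]` of the two sides of a simple curve (Ann. Probab. 44 (2016),
§1.4) — Pommerenke's conformal welding `f*⁻¹ ∘ f` (1992, §2.3 and §6.5 (10)) of the two banks —
in normalised half-plane charts; by uniqueness of normalised uniformisers (Pommerenke 1992,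
Cor. 2.7) the value does not depend on the chosen configuration (`conformalWelding_spec` isolates
exactly this input). It is the functional `W Q γ x` pinned by the route
`CriticalPhenomena/SAWWeldingIdentification` (item `WeldingSetup`).
[cite: Sheffield2016, §1.4 (Thms. 1.3–1.4)] -/
def conformalWelding (Q : ConformalRectangle) (γ : CurveClass ℂ) : ℝ → ℝ :=
  if h : (Q.chord 0 2 (by decide)).IsSimpleChord γ ∧ Nonempty (WeldingConfig Q γ) then
    (Classical.choice h.2).weld
  else 0

section API

variable {Q : ConformalRectangle} {γ : CurveClass ℂ}

/-- Junk value: the conformal welding of a curve class that is not a simple chord of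
`Q.chord 0 2` is the zero function. [folklore] -/
theorem conformalWelding_of_not_isSimpleChord (h : ¬ (Q.chord 0 2 (by decide)).IsSimpleChord γ) :
    conformalWelding Q γ = 0 := by
  unfold conformalWelding
  exact dif_neg fun h' => h h'.1

/-- Junk value: without any welding configuration the conformal welding is the zero function.
[folklore] -/
theorem conformalWelding_of_isEmpty (h : IsEmpty (WeldingConfig Q γ)) :
    conformalWelding Q γ = 0 := by
  unfold conformalWelding
  exact dif_neg fun h' => h.false (Classical.choice h'.2)

/-- For a simple chord with a welding configuration, the conformal welding is the welding
function of SOME configuration (the chosen one). [folklore] -/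
theorem exists_conformalWelding_eq_weld (hγ : (Q.chord 0 2 (by decide)).IsSimpleChord γ)
    (c : WeldingConfig Q γ) : ∃ c₀ : WeldingConfig Q γ, conformalWelding Q γ = c₀.weld := by
  have h : (Q.chord 0 2 (by decide)).IsSimpleChord γ ∧ Nonempty (WeldingConfig Q γ) := ⟨hγ, ⟨c⟩⟩
  refine ⟨Classical.choice h.2, ?_⟩
  unfold conformalWelding
  rw [dif_pos h]

/-- The conformal welding is either the junk zero function or the welding function of a
configuration of a simple chord. [folklore] -/
theorem conformalWelding_eq_zero_or :
    conformalWelding Q γ = 0 ∨ ((Q.chord 0 2 (by decide)).IsSimpleChord γ ∧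
      ∃ c₀ : WeldingConfig Q γ, conformalWelding Q γ = c₀.weld) := by
  by_cases h : (Q.chord 0 2 (by decide)).IsSimpleChord γ ∧ Nonempty (WeldingConfig Q γ)
  · obtain ⟨hγ, ⟨c⟩⟩ := h
    exact Or.inr ⟨hγ, exists_conformalWelding_eq_weld hγ c⟩
  · refine Or.inl ?_
    unfold conformalWelding
    rw [dif_neg h]

/-- Junk value: the conformal welding vanishes at non-positive parameters (the welding
homeomorphism lives on `(0, ∞)`). [folklore] -/
theorem conformalWelding_of_nonpos {x : ℝ} (hx : x ≤ 0) : conformalWelding Q γ x = 0 := by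
  rcases (conformalWelding_eq_zero_or (Q := Q) (γ := γ)) with h | ⟨-, c₀, h⟩
  · rw [h, Pi.zero_apply]
  · rw [h, c₀.weld_of_nonpos hx]

/-- The conformal welding is non-negative. [folklore] -/
theorem conformalWelding_nonneg (x : ℝ) : 0 ≤ conformalWelding Q γ x := by
  rcases (conformalWelding_eq_zero_or (Q := Q) (γ := γ)) with h | ⟨-, c₀, h⟩
  · rw [h, Pi.zero_apply]
  · rw [h]; exact c₀.weld_nonneg x

/-- Where the conformal welding is positive, the parameter is positive and `γ` is a simple chord
of `Q.chord 0 2`. [folklore] -/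
theorem pos_and_isSimpleChord_of_conformalWelding_pos {x : ℝ} (h : 0 < conformalWelding Q γ x) :
    0 < x ∧ (Q.chord 0 2 (by decide)).IsSimpleChord γ := by
  rcases (conformalWelding_eq_zero_or (Q := Q) (γ := γ)) with h0 | ⟨hγ, c₀, h0⟩
  · rw [h0, Pi.zero_apply] at h
    exact absurd h (lt_irrefl 0)
  · rw [h0] at h
    exact ⟨((c₀.weld_pos_iff).1 h).1, hγ⟩

/-- **Configuration independence makes the welding canonical**: if the welding relation of every
configuration agrees with that of `c` at positive parameters (uniqueness of
three-point-normalised uniformisers, Pommerenke 1992 Cor. 2.7, plus identification of the sign and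
of the banks), then the conformal welding of the simple chord `γ` IS the welding function of `c`.
[folklore] -/
theorem conformalWelding_eq_weld (hγ : (Q.chord 0 2 (by decide)).IsSimpleChord γ)
    (c : WeldingConfig Q γ)
    (hindep : ∀ (c' : WeldingConfig Q γ) (x y : ℝ), 0 < x → 0 < y → (c'.IsWeld x y ↔ c.IsWeld x y)) :
    conformalWelding Q γ = c.weld := by
  obtain ⟨c₀, h0⟩ := exists_conformalWelding_eq_weld hγ c
  rw [h0]
  exact c₀.weld_eq_weld_of_iff c (hindep c₀)

/-- **Reduction of `WeldingSetup` (ii) to its two classical inputs.** Let `γ` be a simple chord of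
`Q.chord 0 2` and `c = (s, L, R, φ, ψ)` a welding configuration. If (a) the welding relation is
configuration independent at positive parameters (Pommerenke 1992 Cor. 2.7) and (b) the relation
of `c` has a positive solution at every `x > 0` (Carathéodory's boundary correspondence maps
`-s·(0, ∞)` under `φ` and `s·(0, ∞)` under `ψ` onto `γ ∖ {a, b}`, Pommerenke 1992 Thm. 2.6), then for
every `x > 0` the conformal welding is positive and solves the welding equation of `c`:
`ψ̄ (s x) = φ̄ (-s · conformalWelding Q γ x)` — verbatim the conclusion of the route item. [folklore] -/
theorem conformalWelding_spec (hγ : (Q.chord 0 2 (by decide)).IsSimpleChord γ)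
    (c : WeldingConfig Q γ)
    (hindep : ∀ (c' : WeldingConfig Q γ) (x y : ℝ), 0 < x → 0 < y → (c'.IsWeld x y ↔ c.IsWeld x y))
    (hex : ∀ x : ℝ, 0 < x → ∃ y : ℝ, 0 < y ∧ c.IsWeld x y) {x : ℝ} (hx : 0 < x) :
    0 < conformalWelding Q γ x ∧ c.IsWeld x (conformalWelding Q γ x) := by
  rw [conformalWelding_eq_weld hγ c hindep]
  exact ⟨c.weld_pos hx (hex x hx), c.isWeld_weld hx (hex x hx)⟩

/-- Under configuration independence the conformal welding at `x > 0` is the UNIQUE positive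
solution of the welding equation of `c` whenever positive solutions are unique (injectivity of the
boundary correspondence of `φ`, Pommerenke 1992 Thm. 2.6). [folklore] -/
theorem conformalWelding_eq_of_isWeld (hγ : (Q.chord 0 2 (by decide)).IsSimpleChord γ)
    (c : WeldingConfig Q γ)
    (hindep : ∀ (c' : WeldingConfig Q γ) (x y : ℝ), 0 < x → 0 < y → (c'.IsWeld x y ↔ c.IsWeld x y))
    {x y : ℝ} (hx : 0 < x) (hy : 0 < y) (hw : c.IsWeld x y)
    (huniq : ∀ ⦃y₁ y₂ : ℝ⦄, 0 < y₁ → 0 < y₂ → c.IsWeld x y₁ → c.IsWeld x y₂ → y₁ = y₂) :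
    conformalWelding Q γ x = y := by
  rw [conformalWelding_eq_weld hγ c hindep]
  exact c.weld_eq_of_isWeld hx hy hw huniq

end API

end Literature.Probability.RandomPlanarGeometry
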